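import Mathlib
import HarnessLib
import Summits.QuantumFields.YangMills.Theses.PencilRigidity
import Summits.QuantumFields.YangMills.Theorems.PencilRigidityCurvatureKernelBoundPerFamily
import Summits.QuantumFields.YangMills.Theorems.PencilRigidityCurvatureKernelBoundLatticeWindowPairOfOne
import Summits.QuantumFields.YangMills.Theorems.PencilRigidityCurvatureKernelBoundLatticeWindowTransfer

/-!
# `CurvatureKernelBound` — the kernel conclusion for ONE witness from its lattice window bound (support for stmt-QuantumFields-11687)

Crux `stmt-QuantumFields-11687` (`PencilRigidity.CurvatureKernelBound`), line `sixteen-charts-analytic-kernel`, skeleton v10 —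
the EXISTENCE-LEG form of the reduction in lattice currency (registered sub-goal `KernelConclusionOfWitnessLattice`). For ONE datum
`(G, r, sch, S₁)` carrying the curvature package `W₁`: reflection positivity of `S₁` in the four diagonal frames (the witness's share
of `DiagonalMirrorRPR`) and the ONE-VARIABLE LATTICE WINDOW BOUND of the scheme — frequently in `k`,
`c_k² |Cov_k(Q_0, Q_z)| ≤ C (a_k‖z‖)^(η−10)` for `z ≠ 0` in the box with `R₀ ≤ ‖z‖`, `a_k‖z‖ ≤ θ` — already give the conclusion of
the crux for `S₁`: a real kernel continuous off `0`, `|K x| ≤ C (1 + ‖x‖^(η−10))`, representing `S₁ 2` on `⁰𝒮`. Composition of the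
landed `KernelConclusionOfWitness` (p101783), `LatticeWindowTransfer` (L3, p115832) and `LatticeWindowPairOfOne` (p111636): this is the
statement a planner folds into the existence leg (`HypercubicLimit` witness + its diagonal RP + its lattice UV bound ⇒ everything the
route's `closes` takes from `CurvatureKernelBound` for that witness). [folklore]
-/

noncomputable section

open scoped BigOperators Topology
open MeasureTheory Filter Set
open Literature.MathematicalPhysics.QuantumLattice Literature.MathematicalPhysics.AQFT
open Literature.MathematicalPhysics.QuantumFieldTheory

namespace Summit.QuantumFields.YangMills.Theorems.CurvatureKernel

/-- **`KernelConclusionOfWitnessLattice`** (registered sub-goal of stmt-QuantumFields-11687). For one datum `(G, r, sch, S₁)` with the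
curvature package `W₁`, the four diagonal frames of `S₁` and the one-variable lattice window bound of `(r, sch)`, the conclusion of
`CurvatureKernelBound` holds for `S₁`. [folklore] -/
theorem KernelConclusionOfWitnessLattice : open Literature.MathematicalPhysics.QuantumLattice Literature.MathematicalPhysics.AQFT Literature.MathematicalPhysics.QuantumFieldTheory in ∀ (G : Type) [Group G] [TopologicalSpace G] [IsTopologicalGroup G] [CompactSpace G] [MeasurableSpace G] [BorelSpace G], IsCompactSimpleLieGroup G → ∀ (r : LatticeRep G) (sch : SpeciesScheme (YMSpecies G)) (S₁ : SchwingerFamily (EuclideanSpace ℝ (Fin 4))), ((∀ (n : ℕ), n ≠ 0 → ∀ (f : Fin n → SchwartzMap (EuclideanSpace ℝ (Fin 4)) ℝ) (F : SchwartzMap (Fin n → (EuclideanSpace ℝ (Fin 4))) ℂ), IsTensorOf F (fun i => ofRealTest (f i)) → IsOffDiagonal F → Filter.Tendsto (fun k : ℕ => ((latticeSchwinger r.ρ sch (fun s => s.F) k n (fun _ => r.curvature) f : ℝ) : ℂ)) Filter.atTop (nhds (S₁ n F))) ∧ (S₁.toLabelled.IsNormalized ∧ S₁.toLabelled.IsHermitian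 ∧ S₁.toLabelled.HasLinearGrowth ∧ S₁.toLabelled.IsReflectionPositive ∧ S₁.toLabelled.IsSymmetric ∧ S₁.toLabelled.HasClusterProperty) ∧ (∀ (n : ℕ) (a : (EuclideanSpace ℝ (Fin 4))) (F : SchwartzMap (Fin n → (EuclideanSpace ℝ (Fin 4))) ℂ), IsOffDiagonal F → S₁ n (translateMulti a F) = S₁ n F) ∧ (∀ (R : (EuclideanSpace ℝ (Fin 4)) ≃ₗᵢ[ℝ] (EuclideanSpace ℝ (Fin 4))), LinearMap.det (R.toLinearEquiv : (EuclideanSpace ℝ (Fin 4)) →ₗ[ℝ] (EuclideanSpace ℝ (Fin 4))) = 1 → (∀ i : Fin 4, ∃ j : Fin 4, R (EuclideanSpace.single i 1) = EuclideanSpace.single j 1 ∨ R (EuclideanSpace.single i 1) = -EuclideanSpace.single j 1) → ∀ (n : ℕ) (F : SchwartzMap (Fin n → (EuclideanSpace ℝ (Fin 4))) ℂ), IsOffDiagonal F → S₁ n (linActMulti R F) = S₁ n F) ∧ (∃ Δ : ℝ, 0 < Δ ∧ S₁.toLabelled.HasMassGap Δ ∧ HasLatticeMassGap r sch Δ)) →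 (∀ (R : (EuclideanSpace ℝ (Fin 4)) ≃ₗᵢ[ℝ] (EuclideanSpace ℝ (Fin 4))) (a b : ℝ), a ^ 2 = 1 / 2 → b ^ 2 = 1 / 2 → R (EuclideanSpace.single 0 1) = a • EuclideanSpace.single 0 1 + b • EuclideanSpace.single 1 1 → (SchwingerFamily.toLabelled (fun n => (S₁ n).comp (linActMulti R))).IsReflectionPositive) → (∃ (C η θ R₀ : ℝ), 0 < η ∧ 0 < θ ∧ ∃ᶠ k in Filter.atTop, ∀ z : Literature.Probability.LatticeModels.Site 4, z ∈ Literature.Probability.LatticeModels.box 4 (sch.L k) → z ≠ 0 → R₀ ≤ ‖siteToE z‖ → sch.a k * ‖siteToE z‖ ≤ θ → (sch.c r.curvature k) ^ 2 * |(∫ U, r.curvature.F (torusLift (sch.side k) U) * r.curvature.F (configShift (-z) (torusLift (sch.side k) U)) ∂(wilsonMeasure r.ρ (sch.β k) : MeasureTheory.Measure (GaugeConfig 4 (sch.side k) G))) - (∫ U, r.curvature.F (torusLift (sch.side k) U) ∂(wilsonMeasure r.ρ (sch.β k) : MeasureTheory.Measure (GaugeConfig 4 (sch.side k) G))) * (∫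 U, r.curvature.F (configShift (-z) (torusLift (sch.side k) U)) ∂(wilsonMeasure r.ρ (sch.β k) : MeasureTheory.Measure (GaugeConfig 4 (sch.side k) G)))| ≤ C * (sch.a k * ‖siteToE z‖) ^ (η - 10)) → ∃ (K : (EuclideanSpace ℝ (Fin 4)) → ℝ) (C η : ℝ), 0 < η ∧ ContinuousOn K {x : (EuclideanSpace ℝ (Fin 4)) | x ≠ 0} ∧ (∀ x : (EuclideanSpace ℝ (Fin 4)), x ≠ 0 → |K x| ≤ C * (1 + ‖x‖ ^ (η - 10))) ∧ ∀ F : SchwartzMap (Fin 2 → (EuclideanSpace ℝ (Fin 4))) ℂ, IsOffDiagonal F → MeasureTheory.Integrable (fun x : Fin 2 → (EuclideanSpace ℝ (Fin 4)) => (K (x 0 - x 1) : ℂ) * F x) ∧ S₁ 2 F = ∫ x : Fin 2 → (EuclideanSpace ℝ (Fin 4)), (K (x 0 - x 1) : ℂ) * F x := by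
  intro G _ _ _ _ _ _ hG r sch S₁ hW₁ hdiag hwin
  exact KernelConclusionOfWitness G r sch S₁ hW₁ hdiag
    (fun K hcont hrep => LatticeWindowTransfer G hG r sch S₁ hW₁ (LatticeWindowPairOfOne G r sch hwin) K hcont hrep)

end Summit.QuantumFields.YangMills.Theorems.CurvatureKernel

end
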